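import Mathlib.Tactic.Group
import Literature.AnabelianGeometry.SemiGraphs.ArithLevelData
import Literature.AnabelianGeometry.SemiGraphs.NotationsConventions
import Literature.AnabelianGeometry.SemiGraphs.TemperedMaximalCompact
import HarnessLib

/-!
# [SemiAnbd] Prop 5.2 (iv) / Thm 5.4, producer row T54-B (GAP-LEDGER G-w4d053-1), ALGEBRAIC HALF:
# `Π^temp_𝔊` as the outer semi-direct product `π₁^temp(𝒢) ⋊^out Π_A` and its chart action

Mochizuki, *Semi-graphs of anabelioids*, Publ. RIMS **42** (2006), §0 p. 5 (outer semi-direct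
products), §5 Def 5.1 (i) p. 62, Prop 5.2 (iii)(iv) p. 64, p. 65 ll. 4–14, Thm 5.4 p. 66
[cite: MochizukiSemiAnbd2006, Prop 5.2 (iv), p. 64].

PROOF-ONLY companion (no definitions) for sub-DAG `plan/L3/SUBDAG-SemiAnbd-Thm54.md`, row T54-B =
`plan/GAP-LEDGER.md` G-w4d053-1 «the real arithmetic tempered fundamental group with its chart action».
The T54 rows (T54-0 … T54-7) take the arithmetic tempered group `Gtp = Π^temp_𝔊`, the inclusion
`ι : π₁^temp(𝒢) → Π^temp_𝔊` and the augmentation `aug : Π^temp_𝔊 → Π_A` as PARAMETERS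
(`ArithmeticCoverings.FundamentalExactSequences`, `ProfiniteSemiGraph.decompositionDataOfChart R ι`,
`ProfiniteSemiGraph.ArithChartAction c ι aug actV actE actB`).  Here the GROUP-THEORETIC part of that
debt is CONSTRUCTED AND PROVED from data living on the tempered chart `c` of abc-iut-L3-t2:

* INPUT (binders, nothing asserted): the outer arithmetic action `ρ : Π_A →* Out(π₁^temp(𝒢))`
  (`EtaleTheta.TopOut c.G`, bi-continuous automorphisms modulo inner ones) — the outer representation
  that Prop 5.2 (iv)'s exact sequence `1 → Π^temp_𝔾 → Π^temp_𝔊 → Π_A → 1` determines, `Π^temp_𝔾`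
  being centre-free — together with the action `baseAct : Π_A →* Aut 𝒢.graph` on the underlying
  semi-graph (Def 5.1 (i)), and the compatibility «some representative of `ρ a` carries the §3
  verticial (edge-like) subgroups at `v` (`e`) to verticial (edge-like) subgroups at `a • v` (`a • e`)»
  = Prop 3.6 (iv) (`ProfiniteSemiGraph.InducedHomOfMorphism`) at the automorphism `ρ_𝔾(a)`, stated as
  an inline hypothesis (`hV`, `hE`) because an `Aut`-action notion on `ProfiniteSemiGraph` (action on
  the anabelioid data) is not yet typed in the tree (G-w4d053-1's recorded gate);
* OUTPUT (theorems): with `Gtp := outerSemidirectProduct ρ = Aut_top(π₁^temp 𝒢) ×_{Out} Π_A`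
  (abc-iut-L3-d2 lineage, `NotationsConventions.lean`, [SemiAnbd] §0 p. 5), `ι := toOuterSemidirectProduct ρ`,
  `aug := outerSemidirectProductSnd ρ`:
  - the exact sequence `1 → π₁^temp(𝒢) → Gtp → Π_A → 1` (`ι` injective by temp-slimness
    `temperedPiSlim_holds`, `ι.range = aug.ker`, `aug` surjective) at ARBITRARY universes
    (the §0 named fact `outerSemidirectProduct_exact` is typed at `Type 0`; the three clauses are
    re-proved polymorphically here, the named fact is not restated);
  - the conjugation formula `g · ι(x) · g⁻¹ = ι(φ_g x)` (`φ_g` = the `Aut`-component of `g`), hence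
    `conjSubgroup g (H.map ι) = (φ_g H).map ι` and `TopOut.mk φ_g = ρ (aug g)`;
  - `ArithChartAction c ι aug actV actE actB` for the action on vertices/edges/branches read off
    `baseAct` — i.e. the `conj_verticial` / `conj_edgeLike` fields of abc-iut-w4-d053's hypothesis
    package are DISCHARGED from `hV`/`hE`, and Def 5.1 (i)(c) is carried over verbatim;
  - the packaged existential `exists_arithTemperedGroup_alg` in the shape of G-w4d053-1.

HONEST SCOPE.  NOT delivered here (stays producer debt T54-B, topological half): the tempered
TOPOLOGY on `Π^temp_𝔊` (print defines `Π^temp_𝔊` as a tempered fundamental group of the temperoid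
`B^temp(𝔊)`, Prop 5.2 (i)–(iii); `IsTempered Gtp`, continuity of `ι`/`aug`), and the derivation of
`hV`/`hE` from an action of `Π_A` on the anabelioid data of `𝒢` via Prop 3.6 (iv).  The carrier lives
in universe `max u w` (not `u`).  Nothing here asserts a statement of the paper beyond what is proved;
no side taken on [IUTchIII] Cor 3.12; typed ≠ proved.
-/

namespace Literature.AnabelianGeometry.SemiGraphs

open Literature.AnabelianGeometry.EtaleTheta
open CategoryTheory

universe u w

/-! ### The outer semi-direct product: polymorphic exactness and the conjugation formula -/

section OuterSemidirect

variable {G : Type*} [Group G] [TopologicalSpace G] {J : Type*} [Group J] (ρ : J →* TopOut G)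

/-- `aug` is the second projection. [cite: MochizukiSemiAnbd2006, §0 p.5] -/
theorem outerSemidirectProductSnd_apply (p : outerSemidirectProduct ρ) :
    outerSemidirectProductSnd ρ p = p.1.2 := rfl

/-- The defining relation of the fibre product: the outer class of the `Aut`-component of `g` is
`ρ (aug g)`. [cite: MochizukiSemiAnbd2006, §0 p.5] -/
theorem mk_fst_eq_rho_snd (p : outerSemidirectProduct ρ) :
    TopOut.mk G p.1.1 = ρ (outerSemidirectProductSnd ρ p) := p.2

/-- Surjectivity of `aug : G ⋊^out J → J`, at arbitrary universes. [cite: MochizukiSemiAnbd2006, §0 p.5] -/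
theorem outerSemidirectProductSnd_surjective : Function.Surjective (outerSemidirectProductSnd ρ) := by
  intro j
  obtain ⟨φ, hφ⟩ := QuotientGroup.mk_surjective (ρ j)
  exact ⟨⟨(φ, j), hφ⟩, rfl⟩

/-- Every representative `φ` of `ρ j` gives the element `(φ, j)` of `G ⋊^out J` over `j`.
[cite: MochizukiSemiAnbd2006, §0 p.5] -/
theorem exists_mem_outerSemidirectProduct_of_rep (j : J) (φ : contMulAut G) (hφ : TopOut.mk G φ = ρ j) :
    ∃ p : outerSemidirectProduct ρ, p.1.1 = φ ∧ outerSemidirectProductSnd ρ p = j :=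
  ⟨⟨(φ, j), hφ⟩, rfl, rfl⟩

/-- Two representatives of the same outer class differ by an inner automorphism: if
`TopOut.mk φ = TopOut.mk ψ` then `ψ = conj g ∘ φ` for some `g`. [cite: MochizukiSemiAnbd2006, §0 p.5] -/
theorem exists_conj_of_mk_eq (φ ψ : contMulAut G) (h : TopOut.mk G φ = TopOut.mk G ψ) :
    ∃ g : G, ∀ x, (ψ : MulAut G) x = g * (φ : MulAut G) x * g⁻¹ := by
  rw [QuotientGroup.mk'_apply, QuotientGroup.mk'_apply, QuotientGroup.eq, Subgroup.mem_subgroupOf] at h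
  obtain ⟨g, hg⟩ := h
  -- `hg : conj g = ↑(φ⁻¹ * ψ)` in `MulAut G`
  refine ⟨(φ : MulAut G) g, fun x => ?_⟩
  have hx : g * x * g⁻¹ = (φ : MulAut G)⁻¹ ((ψ : MulAut G) x) := by
    have := DFunLike.congr_fun hg x
    simpa only [MulAut.conj_apply, Subgroup.coe_mul, InvMemClass.coe_inv, MulAut.mul_apply] using this
  have h2 := congrArg (φ : MulAut G) hx
  rw [map_mul, map_mul, map_inv, MulAut.apply_inv_self] at h2
  exact h2.symm

variable [IsTopologicalGroup G]

/-- The `Aut`-component of `ι(x) = (conj x, 1)` is `conj x`. [cite: MochizukiSemiAnbd2006, §0 p.5] -/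
theorem toOuterSemidirectProduct_fst_apply (x y : G) :
    ((toOuterSemidirectProduct ρ x).1.1 : MulAut G) y = x * y * x⁻¹ := rfl

/-- The `J`-component of `ι(x)` is `1`. [cite: MochizukiSemiAnbd2006, §0 p.5] -/
@[simp] theorem toOuterSemidirectProduct_snd (x : G) : (toOuterSemidirectProduct ρ x).1.2 = 1 := rfl

/-- `aug (ι x) = 1`. [cite: MochizukiSemiAnbd2006, §0 p.5] -/
@[simp] theorem outerSemidirectProductSnd_toOuterSemidirectProduct (x : G) :
    outerSemidirectProductSnd ρ (toOuterSemidirectProduct ρ x) = 1 := rfl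

/-- `aug ∘ ι = 1`. [cite: MochizukiSemiAnbd2006, §0 p.5] -/
theorem outerSemidirectProductSnd_comp_toOuterSemidirectProduct :
    (outerSemidirectProductSnd ρ).comp (toOuterSemidirectProduct ρ) = 1 := by
  ext x; rfl

/-- **Conjugation formula**: `g · ι(x) · g⁻¹ = ι(φ_g x)` where `φ_g` is the `Aut`-component of
`g ∈ G ⋊^out J`. [cite: MochizukiSemiAnbd2006, §0 p.5] -/
theorem conj_toOuterSemidirectProduct (p : outerSemidirectProduct ρ) (x : G) :
    p * toOuterSemidirectProduct ρ x * p⁻¹ = toOuterSemidirectProduct ρ ((p.1.1 : MulAut G) x) := by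
  apply Subtype.ext
  refine Prod.ext ?_ ?_
  · -- the `Aut`-component: `φ ∘ conj x ∘ φ⁻¹ = conj (φ x)`
    apply Subtype.ext
    ext y
    change (p.1.1 : MulAut G) (x * (p.1.1 : MulAut G)⁻¹ y * x⁻¹) = (p.1.1 : MulAut G) x * y * ((p.1.1 : MulAut G) x)⁻¹
    simp only [map_mul, map_inv, MulAut.apply_inv_self]
  · -- the `J`-component: `j · 1 · j⁻¹ = 1`
    change p.1.2 * 1 * p.1.2⁻¹ = 1
    group

/-- Subgroup form of the conjugation formula: `g · ι(H) · g⁻¹ = ι(φ_g H)`.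
[cite: MochizukiSemiAnbd2006, §0 p.5] -/
theorem conjSubgroup_map_toOuterSemidirectProduct (p : outerSemidirectProduct ρ) (H : Subgroup G) :
    conjSubgroup p (H.map (toOuterSemidirectProduct ρ)) =
      (H.map (p.1.1 : MulAut G).toMonoidHom).map (toOuterSemidirectProduct ρ) := by
  ext q
  simp only [conjSubgroup, Subgroup.mem_map, MulEquiv.coe_toMonoidHom, MulAut.conj_apply,
    exists_exists_and_eq_and]
  constructor
  · rintro ⟨x, hx, rfl⟩
    exact ⟨x, hx, (conj_toOuterSemidirectProduct ρ p x).symm⟩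
  · rintro ⟨x, hx, rfl⟩
    exact ⟨x, hx, conj_toOuterSemidirectProduct ρ p x⟩

/-- `ι(G)` is normal in `G ⋊^out J`. [cite: MochizukiSemiAnbd2006, §0 p.5] -/
theorem range_toOuterSemidirectProduct_normal : (toOuterSemidirectProduct ρ).range.Normal := by
  refine ⟨fun q hq p => ?_⟩
  obtain ⟨x, rfl⟩ := hq
  exact ⟨(p.1.1 : MulAut G) x, (conj_toOuterSemidirectProduct ρ p x).symm⟩

/-- Exactness in the middle, at arbitrary universes (no hypothesis on `G`): `ι(G) = ker(aug)`.
[cite: MochizukiSemiAnbd2006, §0 p.5] -/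
theorem range_toOuterSemidirectProduct_eq_ker :
    (toOuterSemidirectProduct ρ).range = (outerSemidirectProductSnd ρ).ker := by
  ext p
  constructor
  · rintro ⟨g, rfl⟩
    exact (outerSemidirectProductSnd ρ).mem_ker.mpr rfl
  · intro hp
    have hp2 : p.1.2 = 1 := (outerSemidirectProductSnd ρ).mem_ker.mp hp
    have hmem : TopOut.mk G p.1.1 = ρ p.1.2 := p.2
    rw [hp2, map_one, QuotientGroup.mk'_apply, QuotientGroup.eq_one_iff,
      Subgroup.mem_subgroupOf] at hmem
    obtain ⟨g, hg⟩ := hmem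
    exact ⟨g, Subtype.ext (Prod.ext (Subtype.ext hg) hp2.symm)⟩

/-- Injectivity of `ι : G → G ⋊^out J` for centre-free `G`, at arbitrary universes.
[cite: MochizukiSemiAnbd2006, §0 p.5] -/
theorem toOuterSemidirectProduct_injective (hZ : Subgroup.center G = ⊥) :
    Function.Injective (toOuterSemidirectProduct ρ) := by
  intro g h heq
  have hc : MulAut.conj g = MulAut.conj h :=
    congrArg (fun p : outerSemidirectProduct ρ => (p.1.1 : MulAut G)) heq
  have hz : h⁻¹ * g ∈ Subgroup.center G := by
    rw [Subgroup.mem_center_iff]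
    intro x
    have hx := DFunLike.congr_fun hc x
    simp only [MulAut.conj_apply] at hx
    calc x * (h⁻¹ * g) = h⁻¹ * (h * x * h⁻¹) * g := by group
      _ = h⁻¹ * (g * x * g⁻¹) * g := by rw [hx]
      _ = h⁻¹ * g * x := by group
  rw [hZ, Subgroup.mem_bot] at hz
  exact (inv_mul_eq_one.mp hz).symm

end OuterSemidirect

/-! ### Slim groups are centre-free -/

/-- A slim topological group is centre-free (the centre centralises the open subgroup `⊤`).
[cite: MochizukiFrdI2008, §0 p.13] -/
theorem center_eq_bot_of_isSlimGroup {G : Type*} [Group G] [TopologicalSpace G]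
    (h : Literature.AlgebraicGeometry.Frobenioids.IsSlimGroup G) : Subgroup.center G = ⊥ := by
  rw [eq_bot_iff]
  intro g hg
  have htop := h.centralizer_eq_bot ⊤ isOpen_univ
  rw [← htop, Subgroup.mem_centralizer_iff]
  intro x _
  exact ((Subgroup.mem_center_iff.mp hg) x)

/-! ### The arithmetic tempered group over the chart -/

namespace ProfiniteSemiGraph

variable {𝒢 : ProfiniteSemiGraph.{u}} (c : TemperedPiChart 𝒢)
  {PA : Type w} [Group PA] (ρ : PA →* TopOut c.G) (baseAct : PA →* Aut 𝒢.graph)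

/-- **Prop 5.2 (iv), exactness over the chart**: for `𝒢` satisfying the standing hypotheses of
Prop 3.6 (so that `π₁^temp(𝒢)` is temp-slim, `temperedPiSlim_holds`), the sequence
`1 → π₁^temp(𝒢) —ι→ π₁^temp(𝒢) ⋊^out Π_A —aug→ Π_A → 1` is exact.
[cite: MochizukiSemiAnbd2006, Prop 5.2 (iv), p. 64] -/
theorem outerAction_exact (h36 : 𝒢.Prop36Hypotheses) :
    Function.Injective (toOuterSemidirectProduct ρ) ∧
      (toOuterSemidirectProduct ρ).range = (outerSemidirectProductSnd ρ).ker ∧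
      Function.Surjective (outerSemidirectProductSnd ρ) :=
  ⟨toOuterSemidirectProduct_injective ρ (center_eq_bot_of_isSlimGroup (temperedPiSlim_holds 𝒢 h36 c)),
    range_toOuterSemidirectProduct_eq_ker ρ, outerSemidirectProductSnd_surjective ρ⟩

/-- If SOME representative of the outer class `ρ a` carries `H ∈ verticialSubgroups c v` into
`verticialSubgroups c v'`, then EVERY representative does (verticial subgroups at a vertex form one
conjugacy class, `conj_mem_verticialSubgroups`). [cite: MochizukiSemiAnbd2006, Thm 3.7 (i), p. 40] -/
theorem map_mem_verticialSubgroups_of_rep {a : PA} {v' : 𝒢.graph.Vertex} {H : Subgroup c.G}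
    (hex : ∃ φ : contMulAut c.G, TopOut.mk c.G φ = ρ a ∧
      H.map (φ : MulAut c.G).toMonoidHom ∈ verticialSubgroups c v')
    (ψ : contMulAut c.G) (hψ : TopOut.mk c.G ψ = ρ a) :
    H.map (ψ : MulAut c.G).toMonoidHom ∈ verticialSubgroups c v' := by
  obtain ⟨φ, hφ, hmem⟩ := hex
  obtain ⟨g, hg⟩ := exists_conj_of_mk_eq φ ψ (hφ.trans hψ.symm)
  have : H.map (ψ : MulAut c.G).toMonoidHom =
      (H.map (φ : MulAut c.G).toMonoidHom).map (MulAut.conj g).toMonoidHom := by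
    rw [Subgroup.map_map]
    congr 1
    ext x
    simp [hg x]
  rw [this]
  exact conj_mem_verticialSubgroups c hmem g

/-- The same for edge-like subgroups (`exists_conj_of_mem_edgeLikeSubgroups` gives one conjugacy class
per edge; conjugates of edge-like subgroups are edge-like). [cite: MochizukiSemiAnbd2006, Thm 3.7 (iii), p. 41] -/
theorem map_mem_edgeLikeSubgroups_of_rep {a : PA} {e' : 𝒢.graph.Edge} {K : Subgroup c.G}
    (hex : ∃ φ : contMulAut c.G, TopOut.mk c.G φ = ρ a ∧
      K.map (φ : MulAut c.G).toMonoidHom ∈ edgeLikeSubgroups c e')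
    (ψ : contMulAut c.G) (hψ : TopOut.mk c.G ψ = ρ a) :
    K.map (ψ : MulAut c.G).toMonoidHom ∈ edgeLikeSubgroups c e' := by
  obtain ⟨φ, hφ, hmem⟩ := hex
  obtain ⟨g, hg⟩ := exists_conj_of_mk_eq φ ψ (hφ.trans hψ.symm)
  have : K.map (ψ : MulAut c.G).toMonoidHom =
      (K.map (φ : MulAut c.G).toMonoidHom).map (MulAut.conj g).toMonoidHom := by
    rw [Subgroup.map_map]
    congr 1
    ext x
    simp [hg x]
  rw [this]
  exact conj_mem_edgeLikeSubgroups' c hmem g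

variable [TopologicalSpace PA]

/-- **Def 5.1 (i) on the chart, DISCHARGED for the outer semi-direct product**: the
`conj_verticial` / `conj_edgeLike` clauses of abc-iut-w4-d053's `ArithChartAction` hold for
`Π^temp_𝔊 := π₁^temp(𝒢) ⋊^out Π_A`, `ι`, `aug` and the vertex/edge/branch actions read off
`baseAct`, GIVEN that some representative of each `ρ a` permutes the §3 verticial and edge-like
subgroups as `baseAct a` permutes vertices and edges (Prop 3.6 (iv) at `ρ_𝔾(a)`, hypotheses
`hV`/`hE`) and Def 5.1 (i)(c) for `baseAct` (`hopen`). [cite: MochizukiSemiAnbd2006, Def 5.1 (i), p. 62] -/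
theorem arithChartAction_outerAction
    (hV : ∀ (a : PA) (v : 𝒢.graph.Vertex) (H : Subgroup c.G), H ∈ verticialSubgroups c v →
      ∃ φ : contMulAut c.G, TopOut.mk c.G φ = ρ a ∧
        H.map (φ : MulAut c.G).toMonoidHom ∈ verticialSubgroups c ((baseAct a).hom.vertexMap v))
    (hE : ∀ (a : PA) (e : 𝒢.graph.Edge) (K : Subgroup c.G), K ∈ edgeLikeSubgroups c e →
      ∃ φ : contMulAut c.G, TopOut.mk c.G φ = ρ a ∧
        K.map (φ : MulAut c.G).toMonoidHom ∈ edgeLikeSubgroups c ((baseAct a).hom.edgeMap e))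
    (hopen : ∃ U : Subgroup PA, IsOpen (U : Set PA) ∧ ∀ a ∈ U,
      (∀ v, (baseAct a).hom.vertexMap v = v) ∧ (∀ e, (baseAct a).hom.edgeMap e = e) ∧
        ∀ b, (baseAct a).hom.branchMap b = b) :
    ArithChartAction c (toOuterSemidirectProduct ρ) (outerSemidirectProductSnd ρ)
      (fun a v => (baseAct a).hom.vertexMap v) (fun a e => (baseAct a).hom.edgeMap e)
      (fun a b => (baseAct a).hom.branchMap b) where
  edgeOf_actB a b := (baseAct a).hom.edgeOf_branchMap b
  abuts_actB a b v h := (baseAct a).hom.abuts_branchMap b v h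
  conj_verticial g v H hH := by
    refine ⟨H.map (g.1.1 : MulAut c.G).toMonoidHom, ?_, conjSubgroup_map_toOuterSemidirectProduct ρ g H⟩
    exact map_mem_verticialSubgroups_of_rep c ρ (hV _ v H hH) g.1.1 (mk_fst_eq_rho_snd ρ g)
  conj_edgeLike g e K hK := by
    refine ⟨K.map (g.1.1 : MulAut c.G).toMonoidHom, ?_, conjSubgroup_map_toOuterSemidirectProduct ρ g K⟩
    exact map_mem_edgeLikeSubgroups_of_rep c ρ (hE _ e K hK) g.1.1 (mk_fst_eq_rho_snd ρ g)
  exists_open_trivial := hopen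

end ProfiniteSemiGraph

/-! ### The packaged existential (carrier in the universe of `𝒢`, as asked by the producer) -/

namespace ProfiniteSemiGraph

variable {𝒢 : ProfiniteSemiGraph.{u}} (c : TemperedPiChart 𝒢)
  {PA : Type u} [Group PA] [TopologicalSpace PA] (ρ : PA →* TopOut c.G) (baseAct : PA →* Aut 𝒢.graph)

/-- **T54-B, algebraic half** (GAP-LEDGER G-w4d053-1 shape, minus the tempered topology): for `𝒢`
under the Prop 3.6 hypotheses with tempered chart `c`, a group `Π_A`, an outer action
`ρ : Π_A → Out(π₁^temp 𝒢)` compatible (in the sense of `hV`/`hE`) with an action `baseAct` on the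
underlying semi-graph satisfying Def 5.1 (i)(c): there EXIST a group `Π^temp_𝔊` IN THE UNIVERSE OF `𝒢` (for `Π_A : Type u`), `ι`, `aug` with
`1 → π₁^temp(𝒢) → Π^temp_𝔊 → Π_A → 1` exact, `ι(π₁^temp 𝒢)` normal, and
`ArithChartAction c ι aug (·•·) (·•·) (·•·)`; the witness is `outerSemidirectProduct ρ` (no topology is
chosen here — producer debt T54-B-top, abc-iut-L3-d2).
[cite: MochizukiSemiAnbd2006, Prop 5.2 (iv), p. 64] -/
theorem exists_arithTemperedGroup_alg (h36 : 𝒢.Prop36Hypotheses)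
    (hV : ∀ (a : PA) (v : 𝒢.graph.Vertex) (H : Subgroup c.G), H ∈ verticialSubgroups c v →
      ∃ φ : contMulAut c.G, TopOut.mk c.G φ = ρ a ∧
        H.map (φ : MulAut c.G).toMonoidHom ∈ verticialSubgroups c ((baseAct a).hom.vertexMap v))
    (hE : ∀ (a : PA) (e : 𝒢.graph.Edge) (K : Subgroup c.G), K ∈ edgeLikeSubgroups c e →
      ∃ φ : contMulAut c.G, TopOut.mk c.G φ = ρ a ∧
        K.map (φ : MulAut c.G).toMonoidHom ∈ edgeLikeSubgroups c ((baseAct a).hom.edgeMap e))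
    (hopen : ∃ U : Subgroup PA, IsOpen (U : Set PA) ∧ ∀ a ∈ U,
      (∀ v, (baseAct a).hom.vertexMap v = v) ∧ (∀ e, (baseAct a).hom.edgeMap e = e) ∧
        ∀ b, (baseAct a).hom.branchMap b = b) :
    ∃ (Gtp : Type u) (_ : Group Gtp) (ι : c.G →* Gtp) (aug : Gtp →* PA),
      Function.Injective ι ∧ ι.range = aug.ker ∧ Function.Surjective aug ∧ ι.range.Normal ∧
        ArithChartAction c ι aug (fun a v => (baseAct a).hom.vertexMap v)
          (fun a e => (baseAct a).hom.edgeMap e) (fun a b => (baseAct a).hom.branchMap b) := by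
  obtain ⟨h1, h2, h3⟩ := outerAction_exact c ρ h36
  exact ⟨outerSemidirectProduct ρ, inferInstance, toOuterSemidirectProduct ρ, outerSemidirectProductSnd ρ,
    h1, h2, h3, range_toOuterSemidirectProduct_normal ρ, arithChartAction_outerAction c ρ baseAct hV hE hopen⟩

end ProfiniteSemiGraph

end Literature.AnabelianGeometry.SemiGraphs
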